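import Literature.GroupTheory.NikolovSegal
import Literature.AnabelianGeometry.SemiGraphs.ArithOuterActionCongruenceFinite
import Literature.AnabelianGeometry.SemiGraphs.ArithOuterActionTranslates

/-!
# [SemiAnbd] Def 5.1 (i)(a) ⇒ congruence-continuity of the arithmetic outer action at finite levels
# (the T54-B residual (R), finite-level part, modulo the NAMED FACT Nikolov–Segal)

Mochizuki, *Semi-graphs of anabelioids*, Publ. RIMS **42** (2006) 221–322, Def 5.1 (i)(a) p. 62
("`π̂₁(A)` is topologically finitely generated"), Prop 5.2 (i)/(ii) p. 63
[cite: MochizukiSemiAnbd2006, Prop 5.2 (i), p. 63]; Nikolov–Segal [cite: NikolovSegal2003, Thm 1.1].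

PROOF-ONLY (no definitions, no named facts; cell row T54-B-top, GAP-LEDGER G-w4d053-1 / G-L3d2g2-1,
L3-lead ruling α21-3; seat abc-iut-L3-d2).  CONDITIONAL on the named fact
`Literature.GroupTheory.NikolovSegalStatement` (taken as a hypothesis `hNS`, D-0014): for a
topologically finitely generated profinite `Π_A` (Def 5.1 (i)(a)) and an outer action
`ρ : Π_A → Out(Π)`, at every finite `ρ`-stable normal level `N₀ ≤ Π` the action is
CONGRUENCE-CONTINUOUS (`congruent_reps_nhds_of_nikolovSegal`, from `exists_congruence_ker`), hence
every finite-index subgroup `N ⊇ N₀` has only finitely many translates under the representatives of `ρ`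
(`finite_translates_of_nikolovSegal`, from `finite_translates_of_congruent_reps`) — the tower half's
binder `hfin` — and the finite-level instances of the topology binder `hK1′`
(`SubgroupPresentation.isOpen_map_levelKer_of_congruent_lifts(_of_simple)`) receive their input `hlift`.

Nothing here refers to the IUT corpus; no side is taken on [IUTchIII] Cor 3.12; typed ≠ proved.
-/

namespace Literature.AnabelianGeometry.SemiGraphs

namespace TemperedExtension

open Literature.AnabelianGeometry.EtaleTheta Literature.GroupTheory Topology Filter

universe u w

variable {G : Type u} [Group G] [TopologicalSpace G] [IsTopologicalGroup G]
  {PA : Type w} [Group PA] [TopologicalSpace PA] [IsTopologicalGroup PA] [CompactSpace PA]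
  [TotallyDisconnectedSpace PA]
  (ρ : PA →* TopOut G)

/-- **Def 5.1 (i)(a) ⇒ congruence-continuity at a finite `ρ`-stable level**, CONDITIONAL on
Nikolov–Segal: if `Π_A` is a topologically finitely generated profinite group then for every finite
`ρ`-stable normal level `N` some neighbourhood of `1` in `Π_A` consists of elements admitting a
representative `≡ id (mod N)`. [cite: MochizukiSemiAnbd2006, Prop 5.2 (i), p. 63] -/
theorem congruent_reps_nhds_of_nikolovSegal (hNS : NikolovSegalStatement.{w})
    (htfg : ∃ S : Finset PA, Dense ((Subgroup.closure (S : Set PA) : Subgroup PA) : Set PA))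
    (N : Subgroup G) [N.Normal] [Finite (G ⧸ N)]
    (hstab : ∀ (a : PA) (α : contMulAut G), TopOut.mk G α = ρ a →
      N.map ((α : MulAut G) : G →* G) = N) :
    ∃ U ∈ 𝓝 (1 : PA), ∀ u ∈ U, ∃ β : contMulAut G,
      TopOut.mk G β = ρ u ∧ ∀ y : G, (β : MulAut G) y * y⁻¹ ∈ N :=
  congruent_reps_nhds_of_finiteIndexOpen ρ N (fun U hU => hNS PA htfg U hU) hstab

/-- **Def 5.1 (i)(a) ⇒ finitely many translates** (the tower's binder `hfin`), CONDITIONAL on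
Nikolov–Segal: for `Π_A` topologically finitely generated profinite and any finite-index `N ≤ Π`
containing a finite `ρ`-stable normal level `N₀`, the set of translates `α(N)` under the representatives
`α` of the `ρ a` is finite. [cite: MochizukiSemiAnbd2006, Prop 5.2 (i), p. 63] -/
theorem finite_translates_of_nikolovSegal (hNS : NikolovSegalStatement.{w})
    (htfg : ∃ S : Finset PA, Dense ((Subgroup.closure (S : Set PA) : Subgroup PA) : Set PA))
    (N₀ : Subgroup G) [N₀.Normal] [Finite (G ⧸ N₀)]
    (hstab : ∀ (a : PA) (α : contMulAut G), TopOut.mk G α = ρ a →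
      N₀.map ((α : MulAut G) : G →* G) = N₀)
    (N : Subgroup G) [N.FiniteIndex] (hle : N₀ ≤ N) :
    Set.Finite {M : Subgroup G | ∃ (a : PA) (α : contMulAut G),
      TopOut.mk G α = ρ a ∧ M = N.map (α : MulAut G).toMonoidHom} := by
  obtain ⟨U, hU, hcong⟩ := congruent_reps_nhds_of_nikolovSegal ρ hNS htfg N₀ hstab
  exact finite_translates_of_congruent_reps ρ N
    ⟨U, hU, fun u hu => by
      obtain ⟨β, hβ, hβN⟩ := hcong u hu
      exact ⟨β, hβ, fun y => hle (hβN y)⟩⟩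

end TemperedExtension

end Literature.AnabelianGeometry.SemiGraphs
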